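import Summits.BirchSwinnertonDyer.BirchSwinnertonDyer.Theorems.UniversalToricDescentTwinChoiceDefs
import Summits.BirchSwinnertonDyer.Rank1Residual.GaloisImage.TorsionIsoImageObstruction
import Literature.NumberTheory.EllipticCurves.LeadingTermBSZOrdinaryProofs
import Literature.NumberTheory.EllipticCurves.Fisher2012.HesseFamilyThreeCongruenceProofs
import Literature.NumberTheory.EllipticCurves.ComplexMultiplicationLocalFactorsAux
import Literature.NumberTheory.EllipticCurves.ManinConstantPotMultiplicativeProofs
import HarnessLib

/-!
# Route `UniversalToricDescent`, crux #3 bucket C (item stmt-BirchSwinnertonDyer-20695): THE HESSIAN IS THE `a₃ = 0` TWIN — every wild curve of `3`-adic type `(v₃c₄, v₃c₆) = (4, ≥ 7)` has a `3`-congruent twin with good supersingular reduction at `3` and `a₃ = 0` (PROVED, unconditional)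

Cell `bsd-wall` (W-ALL lane 3, row 2·3@3), seat `bsd-wall-utd-p2` g7 (LEAD, line mode on crux
`TwinSplitIMCAtThree GoodSS`, item 20695), 2026-08-27. `--supports stmt-BirchSwinnertonDyer-20695`.

WHAT IS PROVED (no `sorry`, no named fact, standard axioms). Let `W/ℚ` be an elliptic curve with
`c₄(W) = 3⁴u`, `3 ∤ u`, `c₆(W) = 3⁷w` (`u, w ∈ ℤ`) — for a globally minimal `W` this is the `3`-adic type
`v₃(c₄) = 4`, `v₃(c₆) ≥ 7` (then `v₃(Δ) = 9`), the type `(4, 7, 9)` (Kodaira `IV*`, wild) of ALL `603`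
bucket-C classes of the cell's twin census (TWIN-PRINT-AT3-v1 §2; utd-idea g9 `steer/HESSIAN-TWIN-v1.tsv`).
Let `D(0:1) = Fisher2012.hessePencil3 c₄ c₆ 0 1 : y² = x³ − 27(4c₆² − 3c₄³)x − 54(9c₄³c₆ − 8c₆³)` be the
Hesse-pencil member of `W` at `(λ:μ) = (0:1)` — the Jacobian of the HESSIAN of `W` (Fisher 2012 Thm. 8.5).
* §1 `numPointsMod_hessianIntModel_three`, `frobeniusTrace_hessianIntModel_three`,
  `three_not_dvd_Δ_hessianIntModel`: the integer model `[0, 0, 0, u³ − 12w², 16w³ − 2u³w]` has `3 ∤ Δ`,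
  `#Ẽ(𝔽₃) = 4`, `a₃ = 0` (its reduction is `y² = x³ + x + c` or `y² = x³ − x`; kernel decision over `𝔽₃`).
* §2 `rescale_hessePencil3_zero_one`: `D(0:1) = [0,0,0, 3¹⁶(u³ − 12w²), 3²⁴(16w³ − 2u³w)]`, and the
  rescaling `u = 3⁴` is that integer model; `modPCongruent_smul_hessePencil3_zero_one`: EVERY model
  `C • D(0:1)` is `3`-congruent to `W` (`O6.ModPCongruent`), by Fisher 2012 Thm. 13.2 (`n = 3`) — which is
  PROVED in the tree (`Fisher2012.thm132_threeCongruent_hessePencil_holds`) — transported along `C`.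
* §3 `hasGoodReductionAtPrime_and_frobeniusTrace_eq_zero`, `goodSS_and_frobeniusTrace_eq_zero`: EVERY
  globally minimal model of `D(0:1)` has good reduction at `3`, `a₃ = 0` (the tree's `frobeniusTrace` of the
  global minimal model, read through the isomorphism-invariant `L(E,s)`), hence `GoodSS · 3`.
* §4 `hasGoodSSApZeroTwinAtThree_of_c₄_c₆`, `hasGoodSSApZeroTwinAtThree_of_padicValRat`: the route's
  SUPPLY predicate `UniversalToricDescentTwinChoice.HasGoodSSApZeroTwinAtThree W`
  (`UniversalToricDescentTwinChoiceDefs.lean`, p578655) holds for every such `W` — integer form and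
  census-type form (`padicValRat 3 W.c₄ = 4`, `7 ≤ padicValRat 3 W.c₆`, `W` globally minimal).
* §5 `exists_goodSS_apZero_surj_twin_of_padicValRat`: with onto mod-`3` image, `W` is ON THE TWIN CELL
  of the W-ALL leaf `WAllExclAddWildRankOneSurjTwin` (a globally minimal, good-supersingular, `a₃ = 0`,
  onto twin exists and is NAMED); the twinless leaf is vacuous on this type.

WHY (cell bookkeeping). The twin-choice kernel (`UniversalToricDescentTwinChoiceKernelAtThree.lean`,
p576995, seat g6) consumes crux #3 only at the ONE twin handed over by the leaf; its §3 / `…ByName` §5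
re-key bucket C to the `a₃ = 0` half of item 20695 GRANTED the supply «a class with a good-ss twin has one
with `a₃ = 0`» (census `603/603`; g6: "folklore-provable … not kernel-provable today without a
ModPCongruent fact for Hesse members"). That fact IS in the tree and proved (Fisher 2012 Thm. 13.2,
`n = 3`, `Literature/…/Fisher2012/HesseFamilyThreeCongruenceProofs.lean`), so the supply is now a THEOREM
on the census type `(4, ≥7)`, with the twin named: the Hessian (utd-idea g9 LENS-MEMO v11 §5–§6,
`CanonicalTraceZeroTwinAtThree` + `HesseMemberCongruent`, both discharged here). What this does NOT do:
it does not prove crux #3 (the anticyclotomic IMC `⊇` at a supersingular `3` — research), it does not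
prove that EVERY wild curve with a good-supersingular twin has type `(4, ≥7)` (census: `603/603`; the
other wild types have additive Hessians, utd-idea g9 law table), and BSD is not proved for any curve here.

HONEST FRAMING: helper theorems `--supports` item 20695; nothing closes; no statement item is filed
(D-0014); no new definition (the Hessian is the tree's `Fisher2012.hessePencil3 · · 0 1`, the integer
model is the tree's `shortWeierstrass`). References: T. Fisher, *The Hessian of a genus one curve*,
Proc. LMS (3) 104 (2012) 613–648 = arXiv:math/0610403, §8 (Hesse polynomials, `n = 3`), Thm. 8.5,
Thm. 13.2 (held: `paper:arxiv-math_0610403` p0012–p0013, p0019) [Fisher2012Hessian]; J. H. Silverman,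
*AEC* VII.1 Rem. 1.1, Prop. VII.1.3(b), VII.5 Prop. 5.1(a), Ex. 8.19(a), VIII.8.3 [SilvermanAEC2009];
J.-P. Serre, Invent. Math. 15 (1972) §1.11 (one local type for good supersingular `3`-torsion)
[Serre1972]; cell memos HOME/bsd-wall-utd-p2/SUPSET-AT3-v9.md §2, §4 and
HOME/bsd-wall-utd-idea/LENS-MEMO-UTD-IDEA-v11.md §5–§6.
-/

set_option autoImplicit false
set_option linter.dupNamespace false

noncomputable section

namespace Summit.BirchSwinnertonDyer.BirchSwinnertonDyer.Theorems.UniversalToricDescentHessianTwin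

open WeierstrassCurve
  Literature.NumberTheory.EllipticCurves
  Literature.NumberTheory.EllipticCurves.Rank1Residual
  Literature.NumberTheory.EllipticCurves.Fisher2012
  Literature.NumberTheory.EllipticCurves.BSZLemma17
  Literature.NumberTheory.Automorphic
  Summit.BirchSwinnertonDyer.Rank1Residual
  Summit.BirchSwinnertonDyer.BirchSwinnertonDyer.Theorems.UniversalToricDescentTwinChoice

/-! ## §1 The integer model `[0, 0, 0, u³ − 12w², 16w³ − 2u³w]` modulo `3` -/

/-- Over `𝔽₃`, every curve `y² = x³ + (a³ − 12b²)x + (16b³ − 2a³b)` with `a ≠ 0` — i.e. `y² = x³ + x + c`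
(`a = 1`) or `y² = x³ − x` (`a = −1`) — has exactly `4` rational points (kernel decision over the nine
pairs `(x, y)`). [folklore] -/
theorem natCard_point_hessianShape_zmod_three : ∀ (a b : ZMod 3), a ≠ 0 →
    Nat.card (⟨0, 0, 0, a ^ 3 - 12 * b ^ 2, 16 * b ^ 3 - 2 * a ^ 3 * b⟩ :
      WeierstrassCurve (ZMod 3)).toAffine.Point = 4 := by
  intro a b ha
  fin_cases a
  · exact absurd rfl ha
  all_goals
    fin_cases b
    all_goals
      rw [natCard_point_eq_one_add_card _ (by decide +kernel)]
      decide +kernel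

/-- Reduction modulo `3` of the integer model `[0, 0, 0, u³ − 12w², 16w³ − 2u³w]`. [folklore] -/
theorem map_hessianIntModel_zmod_three (u w : ℤ) :
    (⟨0, 0, 0, u ^ 3 - 12 * w ^ 2, 16 * w ^ 3 - 2 * u ^ 3 * w⟩ : WeierstrassCurve ℤ).map
        (Int.castRingHom (ZMod 3)) =
      ⟨0, 0, 0, (u : ZMod 3) ^ 3 - 12 * (w : ZMod 3) ^ 2,
        16 * (w : ZMod 3) ^ 3 - 2 * (u : ZMod 3) ^ 3 * (w : ZMod 3)⟩ := by
  rw [map_shortModel]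
  simp

/-- **`#Ẽ(𝔽₃) = 4`** for the integer model `[0, 0, 0, u³ − 12w², 16w³ − 2u³w]` whenever `3 ∤ u`
(reduce modulo `3` and count). [folklore] -/
theorem numPointsMod_hessianIntModel_three (u w : ℤ) (hu : ¬ (3 : ℤ) ∣ u) :
    numPointsMod ⟨0, 0, 0, u ^ 3 - 12 * w ^ 2, 16 * w ^ 3 - 2 * u ^ 3 * w⟩ 3 = 4 := by
  unfold numPointsMod
  rw [map_hessianIntModel_zmod_three]
  refine natCard_point_hessianShape_zmod_three _ _ ?_
  rw [ne_eq, ZMod.intCast_zmod_eq_zero_iff_dvd]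
  exact_mod_cast hu

/-- **`a₃ = 0`** for the integer model `[0, 0, 0, u³ − 12w², 16w³ − 2u³w]` (`3 ∤ u`): `3 + 1 − 4 = 0`.
[folklore] -/
theorem frobeniusTrace_hessianIntModel_three (u w : ℤ) (hu : ¬ (3 : ℤ) ∣ u) :
    Literature.NumberTheory.Automorphic.frobeniusTrace
      ⟨0, 0, 0, u ^ 3 - 12 * w ^ 2, 16 * w ^ 3 - 2 * u ^ 3 * w⟩ 3 = 0 := by
  rw [Literature.NumberTheory.Automorphic.frobeniusTrace, numPointsMod_hessianIntModel_three u w hu]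
  norm_num

/-- **`3 ∤ Δ`** for the integer model `[0, 0, 0, u³ − 12w², 16w³ − 2u³w]` (`3 ∤ u`):
`Δ = −16(4A³ + 27B²) ≡ −A³ ≡ −u⁹ (mod 3)`. [folklore] -/
theorem three_not_dvd_Δ_hessianIntModel (u w : ℤ) (hu : ¬ (3 : ℤ) ∣ u) :
    ¬ (3 : ℤ) ∣ (⟨0, 0, 0, u ^ 3 - 12 * w ^ 2, 16 * w ^ 3 - 2 * u ^ 3 * w⟩ : WeierstrassCurve ℤ).Δ := by
  rw [int_Δ]
  intro h
  apply hu
  have h3 : ((-16 * (4 * (u ^ 3 - 12 * w ^ 2) ^ 3 + 27 * (16 * w ^ 3 - 2 * u ^ 3 * w) ^ 2) : ℤ) :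
      ZMod 3) = 0 := by
    rw [ZMod.intCast_zmod_eq_zero_iff_dvd]; exact_mod_cast h
  have hu3 : (u : ZMod 3) = 0 := by
    push_cast at h3
    generalize (u : ZMod 3) = a at h3 ⊢
    generalize (w : ZMod 3) = b at h3
    revert a b
    decide
  rw [ZMod.intCast_zmod_eq_zero_iff_dvd] at hu3
  exact_mod_cast hu3


/-! ## §2 The Hesse member `D(0:1)` of a curve with `c₄ = 3⁴u`, `c₆ = 3⁷w` -/

/-- **`D(0:1)` in closed form on the type `(4, ≥ 7)`**: if `c₄ = 3⁴u` and `c₆ = 3⁷w` then Fisher's member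
`E_{0,1} : y² = x³ − 27·𝔠₄(0,1)x − 54·𝔠₆(0,1)` (`𝔠₄(0,1) = 4c₆² − 3c₄³`, `𝔠₆(0,1) = 9c₄³c₆ − 8c₆³`) is
`[0, 0, 0, 3¹⁶(u³ − 12w²), 3²⁴(16w³ − 2u³w)]`. [cite: Fisher2012Hessian, §8 (Hesse polynomials, n = 3)] -/
theorem hessePencil3_zero_one_eq (W : WeierstrassCurve ℚ) (u w : ℤ) (h4 : W.c₄ = 3 ^ 4 * u)
    (h7 : W.c₆ = 3 ^ 7 * w) :
    hessePencil3 W.c₄ W.c₆ 0 1 =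
      ⟨0, 0, 0, (3 : ℚ) ^ 16 * ((u ^ 3 - 12 * w ^ 2 : ℤ) : ℚ),
        (3 : ℚ) ^ 24 * ((16 * w ^ 3 - 2 * u ^ 3 * w : ℤ) : ℚ)⟩ := by
  rw [hessePencil3_eq, h4, h7]
  push_cast
  simp only [WeierstrassCurve.mk.injEq, true_and]
  constructor <;> ring

/-- **The rescaling `u = 3⁴` of `D(0:1)` is the integer model** `E_{A,B} = [0, 0, 0, A, B]` with
`A = u³ − 12w²`, `B = 16w³ − 2u³w` (the tree's `shortWeierstrass (A, B)`). [folklore] -/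
theorem rescale_hessePencil3_zero_one (W : WeierstrassCurve ℚ) (u w : ℤ) (h4 : W.c₄ = 3 ^ 4 * u)
    (h7 : W.c₆ = 3 ^ 7 * w) :
    (⟨Units.mk0 ((3 : ℚ) ^ 4) (by norm_num), 0, 0, 0⟩ : VariableChange ℚ) •
        hessePencil3 W.c₄ W.c₆ 0 1 =
      shortWeierstrass (u ^ 3 - 12 * w ^ 2, 16 * w ^ 3 - 2 * u ^ 3 * w) := by
  rw [hessePencil3_zero_one_eq W u w h4 h7, shortWeierstrass, variableChange_def]
  simp only [Units.val_inv_eq_inv_val, Units.val_mk0, WeierstrassCurve.mk.injEq]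
  push_cast
  refine ⟨by ring, by ring, by ring, by ring, by ring⟩

/-- `D(0:1)` is an elliptic curve as soon as `c₄ ≠ 0` (`𝔇(0,1) = −3c₄²`; Fisher 2012 §8: the singular
members are the roots of `𝔇`). [cite: Fisher2012Hessian, §8 and Thm. 13.2 (n = 3)] -/
theorem isElliptic_hessePencil3_zero_one (W : WeierstrassCurve ℚ) [W.IsElliptic] (hc4 : W.c₄ ≠ 0) :
    (hessePencil3 W.c₄ W.c₆ 0 1).IsElliptic :=
  isElliptic_hessePencil3_of_eval_hesseD3_ne_zero W.c₄ W.c₆ 0 1 (by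
    rw [eval_hesseD3]
    have h : (0 : ℚ) ^ 4 - 6 * W.c₄ * 0 ^ 2 * 1 ^ 2 - 8 * W.c₆ * 0 * 1 ^ 3 - 3 * W.c₄ ^ 2 * 1 ^ 4 =
        -3 * W.c₄ ^ 2 := by ring
    rw [h]
    exact mul_ne_zero (by norm_num) (pow_ne_zero 2 hc4))

/-- **`D(0:1)` is `3`-congruent to `E`, on every model** — Fisher 2012 Thm. 13.2 (`n = 3`, PROVED in the
tree: `thm132_threeCongruent_hessePencil_holds`) transported along the `ℚ`-isomorphism `C`:
`(C • D(0:1))[3] ≅ E[3]` as `Γ_ℚ`-modules, i.e. `O6.ModPCongruent (C • D(0:1)) W 3`. Unconditional.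
[cite: Fisher2012Hessian, Thm. 13.2 (n = 3)] -/
theorem modPCongruent_smul_hessePencil3_zero_one (W : WeierstrassCurve ℚ) [W.IsElliptic]
    (hc4 : W.c₄ ≠ 0) (C : VariableChange ℚ) :
    O6.ModPCongruent (C • hessePencil3 W.c₄ W.c₆ 0 1) W 3 := by
  haveI := isElliptic_hessePencil3_zero_one W hc4
  obtain ⟨e₁, he₁⟩ := threeCongruent_hessePencil3_unconditional W 0 1
  obtain ⟨e₂, he₂⟩ := (hessePencil3 W.c₄ W.c₆ 0 1).exists_geomTorsion_addEquiv_smul C 3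
  refine ⟨e₂.symm.trans e₁, fun σ P ↦ ?_⟩
  simp only [AddEquiv.trans_apply]
  rw [← he₁]
  congr 1
  apply e₂.injective
  rw [AddEquiv.apply_symm_apply, he₂, AddEquiv.apply_symm_apply]

/-! ## §3 Every global minimal model of `D(0:1)` is good at `3` with `a₃ = 0` -/

/-- **The Hessian twin is good supersingular with `a₃ = 0` at `3` (core form).** If `c₄(W) = 3⁴u` with
`3 ∤ u` and `c₆(W) = 3⁷w` (`u, w ∈ ℤ`), then EVERY globally minimal model `C • D(0:1)` of the Hesse
member `D(0:1)` of `W` has good reduction at `3` and `a₃ = 0` (the tree's `frobeniusTrace` on the global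
minimal model): `(3⁴·C⁻¹)`-rescaling gives the integer model `[0,0,0,u³−12w²,16w³−2u³w]` with `3 ∤ Δ`
and `#Ẽ(𝔽₃) = 4`, and `a₃` is read through the isomorphism-invariant `L(E, s)`
(`BSZLemma17.frobeniusTrace_eq_of_smul_eq_shortWeierstrass`). [folklore] -/
theorem hasGoodReductionAtPrime_and_frobeniusTrace_eq_zero (W : WeierstrassCurve ℚ) (u w : ℤ)
    (hu : ¬ (3 : ℤ) ∣ u) (h4 : W.c₄ = 3 ^ 4 * u) (h7 : W.c₆ = 3 ^ 7 * w) (C : VariableChange ℚ)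
    [(C • hessePencil3 W.c₄ W.c₆ 0 1).IsElliptic] [(C • hessePencil3 W.c₄ W.c₆ 0 1).IsGloballyMinimal] :
    (C • hessePencil3 W.c₄ W.c₆ 0 1).HasGoodReductionAtPrime 3 ∧
      (C • hessePencil3 W.c₄ W.c₆ 0 1).frobeniusTrace 3 = 0 := by
  set M := C • hessePencil3 W.c₄ W.c₆ 0 1 with hM
  set C₁ : VariableChange ℚ := ⟨Units.mk0 ((3 : ℚ) ^ 4) (by norm_num), 0, 0, 0⟩ with hC₁
  have hkey : (C₁ * C⁻¹) • M =
      shortWeierstrass (u ^ 3 - 12 * w ^ 2, 16 * w ^ 3 - 2 * u ^ 3 * w) := by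
    rw [hM, mul_smul, inv_smul_smul]
    exact rescale_hessePencil3_zero_one W u w h4 h7
  have hΔ := three_not_dvd_Δ_hessianIntModel u w hu
  refine ⟨?_, ?_⟩
  · rw [← hasGoodReductionAtPrime_smul_iff M (C₁ * C⁻¹) 3, hkey]
    exact hasGoodReductionAtPrime_shortWeierstrass_of_not_dvd_Δ 3 hΔ
  · rw [frobeniusTrace_eq_of_smul_eq_shortWeierstrass hkey 3 hΔ]
    exact frobeniusTrace_hessianIntModel_three u w hu

/-- **`GoodSS` form**: every global minimal model of the Hessian twin is good supersingular at `3`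
(`GoodSS · 3`: good reduction and `3 ∣ a₃`, here `a₃ = 0`) with `a₃ = 0`. [folklore] -/
theorem goodSS_and_frobeniusTrace_eq_zero (W : WeierstrassCurve ℚ) (u w : ℤ)
    (hu : ¬ (3 : ℤ) ∣ u) (h4 : W.c₄ = 3 ^ 4 * u) (h7 : W.c₆ = 3 ^ 7 * w) (C : VariableChange ℚ)
    [(C • hessePencil3 W.c₄ W.c₆ 0 1).IsElliptic] [(C • hessePencil3 W.c₄ W.c₆ 0 1).IsGloballyMinimal] :
    GoodSS (C • hessePencil3 W.c₄ W.c₆ 0 1) 3 ∧ (C • hessePencil3 W.c₄ W.c₆ 0 1).frobeniusTrace 3 = 0 := by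
  obtain ⟨hg, h0⟩ := hasGoodReductionAtPrime_and_frobeniusTrace_eq_zero W u w hu h4 h7 C
  exact ⟨⟨hg, by rw [h0]; exact dvd_zero _⟩, h0⟩

/-! ## §4 The supply statement on the type `(4, ≥ 7)`: `HasGoodSSApZeroTwinAtThree W` -/

/-- **THE HESSIAN IS THE `a₃ = 0` TWIN (integer form).** If `c₄(W) = 3⁴u`, `3 ∤ u`, `c₆(W) = 3⁷w`, then `W`
has a `Γ_ℚ`-equivariantly `3`-congruent twin with good supersingular reduction at `3` and `a₃ = 0` —
namely any global minimal model of its Hesse member `D(0:1)` (which exists: Néron / Silverman VIII.8.3,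
tree-proved `hasGlobalMinimalModel_rat_holds`). This is the route's supply predicate
`UniversalToricDescentTwinChoice.HasGoodSSApZeroTwinAtThree W`, UNCONDITIONALLY. [folklore] -/
theorem hasGoodSSApZeroTwinAtThree_of_c₄_c₆ (W : WeierstrassCurve ℚ) [W.IsElliptic] (u w : ℤ)
    (hu : ¬ (3 : ℤ) ∣ u) (h4 : W.c₄ = 3 ^ 4 * u) (h7 : W.c₆ = 3 ^ 7 * w) :
    HasGoodSSApZeroTwinAtThree W := by
  have hc4 : W.c₄ ≠ 0 := by
    rw [h4]
    refine mul_ne_zero (by norm_num) ?_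
    intro h
    have hu0 : u = 0 := by exact_mod_cast h
    exact hu (hu0 ▸ dvd_zero 3)
  haveI := isElliptic_hessePencil3_zero_one W hc4
  obtain ⟨C, hC⟩ := WeierstrassCurve.hasGlobalMinimalModel_rat_holds (hessePencil3 W.c₄ W.c₆ 0 1)
  haveI := hC
  obtain ⟨hss, h0⟩ := goodSS_and_frobeniusTrace_eq_zero W u w hu h4 h7 C
  exact ⟨C • hessePencil3 W.c₄ W.c₆ 0 1, inferInstance, hC,
    modPCongruent_smul_hessePencil3_zero_one W hc4 C, hss, h0⟩

/-- The invariant `c₆` of a globally minimal `W/ℚ` is the integer `c₆` of its `ℤ`-model (companion of the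
tree's `c₄_eq_intCast_c₄_integralModelInt`). [folklore] -/
theorem c₆_eq_intCast_c₆_integralModelInt (W : WeierstrassCurve ℚ) [W.IsGloballyMinimal] :
    W.c₆ = ((integralModelInt W).c₆ : ℚ) := by
  conv_lhs => rw [← map_integralModelInt W]
  rw [map_c₆, eq_intCast]

/-- `v₃(n) = 4` for an integer `n` (read in `ℚ`) means `n = 3⁴u` with `3 ∤ u`. [folklore] -/
theorem exists_eq_pow_four_mul_of_padicValRat_eq_four (n : ℤ) (h : padicValRat 3 (n : ℚ) = 4) :
    ∃ u : ℤ, ¬ (3 : ℤ) ∣ u ∧ n = 3 ^ 4 * u := by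
  rw [padicValRat.of_int] at h
  have h' : padicValInt 3 n = 4 := by exact_mod_cast h
  have hn : n ≠ 0 := by rintro rfl; simp at h'
  obtain ⟨u, hu⟩ : (3 : ℤ) ^ 4 ∣ n :=
    (padicValInt_dvd_iff 4 n).mpr (Or.inr h'.ge)
  refine ⟨u, fun h3 ↦ ?_, hu⟩
  have h5 : (3 : ℤ) ^ 5 ∣ n := by
    rw [hu, pow_succ]
    exact mul_dvd_mul_left _ h3
  rcases (padicValInt_dvd_iff 5 n).mp (by exact_mod_cast h5) with h0 | h5'
  · exact hn h0
  · omega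

/-- `v₃(n) ≥ 7` for a nonzero integer `n` (read in `ℚ`) gives `n = 3⁷w`. [folklore] -/
theorem exists_eq_pow_seven_mul_of_le_padicValRat (n : ℤ) (h : 7 ≤ padicValRat 3 (n : ℚ)) :
    ∃ w : ℤ, n = 3 ^ 7 * w := by
  rw [padicValRat.of_int] at h
  have h' : 7 ≤ padicValInt 3 n := by exact_mod_cast h
  obtain ⟨w, hw⟩ : (3 : ℤ) ^ 7 ∣ n := (padicValInt_dvd_iff 7 n).mpr (Or.inr h')
  exact ⟨w, hw⟩

/-- **THE HESSIAN IS THE `a₃ = 0` TWIN (census-type form).** Every globally minimal `W/ℚ` of `3`-adic type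
`v₃(c₄) = 4`, `v₃(c₆) ≥ 7` — in particular the type `(v₃c₄, v₃c₆, v₃Δ) = (4, 7, 9)` of ALL `603` bucket-C
classes of the cell's twin census (utd-idea g9: `steer/D01_witness_allC.tsv`, `603/603`) — satisfies
`HasGoodSSApZeroTwinAtThree W`: a `3`-congruent twin, good supersingular at `3` with `a₃ = 0`, EXISTS and
is NAMED (a global minimal model of the Hessian `D(0:1)`). No named fact, no census input: a theorem for
every curve of that type. (utd-idea g9's `CanonicalTraceZeroTwinAtThree` + `HesseMemberCongruent`, both
discharged.) BSD is not proved for any curve here. [folklore] -/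
theorem hasGoodSSApZeroTwinAtThree_of_padicValRat (W : WeierstrassCurve ℚ) [W.IsElliptic]
    [W.IsGloballyMinimal] (h4 : padicValRat 3 W.c₄ = 4) (h7 : 7 ≤ padicValRat 3 W.c₆) :
    HasGoodSSApZeroTwinAtThree W := by
  rw [c₄_eq_intCast_c₄_integralModelInt W] at h4
  rw [c₆_eq_intCast_c₆_integralModelInt W] at h7
  obtain ⟨u, hu, hu'⟩ := exists_eq_pow_four_mul_of_padicValRat_eq_four _ h4
  obtain ⟨w, hw'⟩ := exists_eq_pow_seven_mul_of_le_padicValRat _ h7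
  refine hasGoodSSApZeroTwinAtThree_of_c₄_c₆ W u w hu ?_ ?_
  · rw [c₄_eq_intCast_c₄_integralModelInt W, hu']; push_cast; ring
  · rw [c₆_eq_intCast_c₆_integralModelInt W, hw']; push_cast; ring

/-! ## §5 Consequences for the twin cell: a type-`(4, ≥7)` wild curve is never twinless -/

/-- **Onto image passes to the Hessian twin.** [folklore] -/
theorem hasSurjectiveModNGaloisRep_of_modPCongruent' {W W' : WeierstrassCurve ℚ}
    (hc : O6.ModPCongruent W' W 3) (hs : W.HasSurjectiveModNGaloisRep 3) :
    W'.HasSurjectiveModNGaloisRep 3 := by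
  obtain ⟨e, he⟩ := hc
  refine GaloisImage.hasSurjectiveModNGaloisRep_of_torsionIso e.symm (fun σ Q ↦ ?_) hs
  apply e.injective
  rw [he, e.apply_symm_apply, e.apply_symm_apply]

/-- **A wild curve of type `(4, ≥ 7)` with onto mod-`3` image is ON THE TWIN CELL**: it has a globally
minimal `3`-congruent twin that is NOT additive at `3` (indeed good supersingular, `a₃ = 0`) with onto
mod-`3` image — the existential hypothesis of the W-ALL leaf `WAllExclAddWildRankOneSurjTwin` holds, and the
twinless leaf `WAllExclAddWildRankOneSurjTwinless` is VACUOUS, on this type. [folklore] -/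
theorem exists_goodSS_apZero_surj_twin_of_padicValRat (W : WeierstrassCurve ℚ) [W.IsElliptic]
    [W.IsGloballyMinimal] (h4 : padicValRat 3 W.c₄ = 4) (h7 : 7 ≤ padicValRat 3 W.c₆)
    (hs : W.HasSurjectiveModNGaloisRep 3) :
    ∃ (W' : WeierstrassCurve ℚ) (_ : W'.IsElliptic) (_ : W'.IsGloballyMinimal),
      O6.ModPCongruent W' W 3 ∧ GoodSS W' 3 ∧ W'.frobeniusTrace 3 = 0 ∧ ¬ Addv W' 3 ∧
        W'.HasSurjectiveModNGaloisRep 3 := by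
  obtain ⟨W', i1, i2, hc, hss, h0⟩ := hasGoodSSApZeroTwinAtThree_of_padicValRat W h4 h7
  exact ⟨W', i1, i2, hc, hss, h0, fun h ↦ h.1 hss.1, hasSurjectiveModNGaloisRep_of_modPCongruent' hc hs⟩

end Summit.BirchSwinnertonDyer.BirchSwinnertonDyer.Theorems.UniversalToricDescentHessianTwin

end
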